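import Summits.HodgeConjecture.HodgeConjecture.Theorems.K2LiuDoublingHeightDecayPointwise     -- ★ p855227: #16a `doublingHeightDecayPointwise`
import Literature.NumberTheory.K2Lit.SiegelEisensteinSeriesDoubled                          -- ★ `IsSiegelDeltaSection` (#14a)
import Mathlib.MeasureTheory.Function.LocallyIntegrable
import Mathlib.MeasureTheory.Function.L1Space.Integrable
import Mathlib.Analysis.SpecialFunctions.Pow.Continuity
import HarnessLib

/-!
# Crux `HLiu418`, Track B road `K2_Liu`, unit U5 «DOUBLING ZETA» — sockets #16 `sig_K2LiuDoublingHeightDecay` (organ (IV-e) assembly) and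
# #14a `sig_K2LiuDoublingSectionIntegrable` REDUCED to socket #16b `sig_K2LiuAdelicNormIntegrable`: `#16b ⇒ #16 ⇒ #14a`, #16a ★ by name

Cell `hodgecm-mathlib`, crux item hLiu418 = `stmt-HodgeConjecture-24832`, route of record `HCCMUnconditional`; squad K2 ∕ K2Liu, prover K2Liu-p04 (g0).
U5 `Cruxes/HLiu418/Lines/K2_Liu_CurveThetaSigs_U5_DoublingZeta.lean` ED. 6 (5cff0c75aa6afdae): #16 :205–:217 (block sha16 7f8479ef17577684) and
#16b :273–:282 (block sha16 98a4d872ac632d4d) are pasted VERBATIM below as conclusion and hypothesis of ONE implication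
`doublingHeightDecay_of_adelicNormIntegrable : ‹#16b› → ‹#16›`, and #14a :59–:70 (block sha16 3d6d85263d1ebad6) likewise as
`doublingSectionIntegrable_of_adelicNormIntegrable : ‹#16b› → ‹#14a›`, so that #16 AND #14a close by single applications the moment #16b
(K2Liu-p03 lineage, organ (IV-d)) lands.  THEOREMS ONLY; lane `--supports stmt-HodgeConjecture-24832 --as helper`.

THE ARGUMENT (LEAD RULING 21:51:22Z (A): «the (IV-e) assembly #16a + #16b ⇒ #16 cases on `N = 0` inside p04's proof»).
* `N = 0`: `U(V)(𝔸) ≤ GL_0(𝔸_L)` is a one-point group, hence compact; `g ↦ Φ(ι(g,1))^τ` is continuous (`Φ > 0` continuous, ★ `continuous_iotaLeft`),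
  so integrable for every Haar (indeed every locally finite) measure and every `τ` — `τ₁ = 0` will do.
* `N ≥ 1`: ★ #16a `doublingHeightDecayPointwise` gives `Φ(ι(g,1)) ≤ C ‖g‖^{-α}` (`C, α > 0`), #16b gives `β₀` with `‖g‖^{-β}` integrable for
  `β > β₀`; for `τ ≥ τ₁ := max ((β₀ + 1) ∕ α) 0` domination `0 < Φ(ι(g,1))^τ ≤ C^τ ‖g‖^{-ατ}`, `ατ ≥ β₀ + 1 > β₀`, and continuity
  (measurability) of the left side give integrability ([GelbartPiatetskishapiroRallis1987, Part A §2]; [Liu2021, Lem. B.10 (2) p. 102]).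

* #14a from #16: ★ (I) `exists_isCompact_isSiegelDelta_mul`, the continuous height of record ★ `exists_siegelHeight_continuous`, and ★ p854882
  `exists_threshold_integrable_comp_iotaLeft_of_continuous_height` ([Liu2021, Lem. B.10 (2)]: `Re s > σ₀`).

HONEST LABEL.  `HC_CM` is proved only modulo the 7 printed citations (2 remaining named inputs: hLiu418 = `stmt-HodgeConjecture-24832`, h413 =
`stmt-HodgeConjecture-24833`) until rung 0 closes; this file retires nothing by itself (#16, #14a stay open until #16b lands).
-/

set_option autoImplicit false
-- the mandated namespace repeats the single-problem summit's segment (`HodgeConjecture.HodgeConjecture`)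
set_option linter.dupNamespace false

noncomputable section

open scoped Matrix NNReal
open NumberField IsDedekindDomain MeasureTheory

namespace Summit.HodgeConjecture.HodgeConjecture.Cruxes.HLiu418.K2LiuDoublingHeightDecayOfNormIntegrable

open Literature.NumberTheory.Automorphic Literature.NumberTheory.Automorphic.UnitaryGroup
open Literature.NumberTheory.GelbartRogawski1991 Literature.NumberTheory.GelbartRogawski1991.GRConstruction
open Literature.NumberTheory.K2Lit.SiegelDoubled
open Literature.NumberTheory.GaloisRepresentations (HeckeCharacter)
open Summit.HodgeConjecture.HodgeConjecture.Cruxes.HLiu418.K2LiuDoublingHeightDecayPointwise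

/-- **`#16b ⇒ #16` (organ (IV-e) of the K2_Liu road's unit U5): WEIL'S INTEGRABILITY CRITERION FOR `U(V)(𝔸)` IMPLIES THE DECAY-INTEGRABILITY OF
EVERY `P_Δ`-HEIGHT ALONG `ι(·,1)`.**  Hypothesis = socket #16b `sig_K2LiuAdelicNormIntegrable` verbatim; conclusion = socket #16
`sig_K2LiuDoublingHeightDecay` verbatim (U5 ED. 6).  `N = 0`: one-point compact group; `N ≥ 1`: ★ #16a + domination.
[cite: GelbartPiatetskishapiroRallis1987, Part A §2] [cite: Liu2021, Lem. B.10 (2) p. 102] [cite: BorelJacquet1979, §1.2 and §4.2] -/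
theorem doublingHeightDecay_of_adelicNormIntegrable
    (h16b :
      ∀ (L : Type) [Field L] [NumberField L] [IsCMField L] {N : ℕ}
        (dV : Fin N → L) (_hdV : ∀ i, IsCMField.complexConj L (dV i) = dV i) (_hdV0 : ∀ i, dV i ≠ 0),
        ∃ β₀ : ℝ, ∀ β : ℝ, β₀ < β →
          ∀ [MeasurableSpace (UnitaryGroup.adelic (Fp L) L (IsCMField.complexConj L) N (Matrix.diagonal dV))]
            [BorelSpace (UnitaryGroup.adelic (Fp L) L (IsCMField.complexConj L) N (Matrix.diagonal dV))]
            (ν : Measure (UnitaryGroup.adelic (Fp L) L (IsCMField.complexConj L) N (Matrix.diagonal dV)))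
            [ν.IsHaarMeasure],
            Integrable (fun g : UnitaryGroup.adelic (Fp L) L (IsCMField.complexConj L) N (Matrix.diagonal dV) =>
              adelicHeightGL N L (g : GL (Fin N) (AdeleRing (𝓞 L) L)) ^ (-β)) ν) :
    ∀ (L : Type) [Field L] [NumberField L] [IsCMField L] {N n : ℕ} (e : Fin N × Fin 1 ≃ Fin n)
      (dV : Fin N → L) (hdV : ∀ i, IsCMField.complexConj L (dV i) = dV i) (_hdV0 : ∀ i, dV i ≠ 0)
      (dW : Fin 1 → L) (hdW : ∀ i, IsCMField.complexConj L (dW i) = dW i) (_hdW0 : ∀ i, dW i ≠ 0)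
      (Φ : HA L e dV hdV dW hdW → ℝ), Continuous Φ → (∀ x, 0 < Φ x) →
      (∀ p x : HA L e dV hdV dW hdW, IsSiegelDelta L e dV hdV dW hdW p →
        Φ (p * x) = modDelta L e dV hdV dW hdW p * Φ x) →
      ∃ τ₁ : ℝ, ∀ τ : ℝ, τ₁ ≤ τ →
        ∀ [MeasurableSpace (UnitaryGroup.adelic (Fp L) L (IsCMField.complexConj L) N (Matrix.diagonal dV))]
          [BorelSpace (UnitaryGroup.adelic (Fp L) L (IsCMField.complexConj L) N (Matrix.diagonal dV))]
          (ν : Measure (UnitaryGroup.adelic (Fp L) L (IsCMField.complexConj L) N (Matrix.diagonal dV)))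
          [ν.IsHaarMeasure],
          Integrable (fun g => Φ (iotaLeft L e dV hdV dW hdW g) ^ τ) ν := by
  intro L _ _ _ N n e dV hdV hdV0 dW hdW hdW0 Φ hΦc hΦpos hΦ
  -- continuity of `g ↦ Φ(ι(g,1))^τ`
  have hcont : ∀ τ : ℝ, Continuous fun g : UnitaryGroup.adelic (Fp L) L (IsCMField.complexConj L) N (Matrix.diagonal dV) =>
      Φ (iotaLeft L e dV hdV dW hdW g) ^ τ := fun τ =>
    (hΦc.comp (continuous_iotaLeft L e dV hdV dW hdW)).rpow_const fun g => Or.inl (hΦpos _).ne'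
  rcases Nat.eq_zero_or_pos N with hN | hN
  · -- `N = 0`: the group is a point
    subst hN
    refine ⟨0, fun τ _ => ?_⟩
    intro _ _ ν _
    have hK : IsCompact (Set.univ : Set (UnitaryGroup.adelic (Fp L) L (IsCMField.complexConj L) 0 (Matrix.diagonal dV))) :=
      ((Set.subsingleton_of_subsingleton).finite).isCompact
    exact integrableOn_univ.1 ((hcont τ).continuousOn.integrableOn_compact' hK MeasurableSet.univ)
  · -- `N ≥ 1`: ★ #16a + domination
    haveI : NeZero N := ⟨hN.ne'⟩
    obtain ⟨C, α, hC, hα, hdec⟩ := doublingHeightDecayPointwise L e dV hdV hdV0 dW hdW hdW0 Φ hΦc hΦpos hΦ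
    obtain ⟨β₀, hβ⟩ := h16b L dV hdV hdV0
    refine ⟨max ((β₀ + 1) / α) 0, fun τ hτ => ?_⟩
    intro _ _ ν _
    have hτ0 : 0 ≤ τ := le_trans (le_max_right _ _) hτ
    have hατ : β₀ < α * τ := by
      have h1 : (β₀ + 1) / α ≤ τ := le_trans (le_max_left _ _) hτ
      rw [div_le_iff₀ hα] at h1
      linarith [h1]
    have hint := hβ (α * τ) hατ ν
    refine Integrable.mono' (hint.const_mul (C ^ τ)) (hcont τ).aestronglyMeasurable (Filter.Eventually.of_forall fun g => ?_)
    rw [Real.norm_eq_abs, abs_of_nonneg (Real.rpow_nonneg (hΦpos _).le τ)]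
    calc Φ (iotaLeft L e dV hdV dW hdW g) ^ τ
        ≤ (C * adelicHeightGL N L (g : GL (Fin N) (AdeleRing (𝓞 L) L)) ^ (-α)) ^ τ :=
          Real.rpow_le_rpow (hΦpos _).le (hdec g) hτ0
      _ = C ^ τ * adelicHeightGL N L (g : GL (Fin N) (AdeleRing (𝓞 L) L)) ^ (-(α * τ)) := by
          rw [Real.mul_rpow hC.le (Real.rpow_nonneg (adelicHeightGL_nonneg _) _), ← Real.rpow_mul (adelicHeightGL_nonneg _),
            neg_mul]

/-- **`#16b ⇒ #14a`: WEIL'S INTEGRABILITY CRITERION FOR `U(V)(𝔸)` IMPLIES THAT CONTINUOUS SIEGEL SECTIONS ARE `L¹` ALONG `ι(·,1)` IN A RIGHT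
HALF-PLANE.**  Hypothesis = socket #16b verbatim; conclusion = socket #14a `sig_K2LiuDoublingSectionIntegrable` verbatim (U5 ED. 3–6 :59, block
sha16 3d6d85263d1ebad6): the Iwasawa decomposition ★ (I) `exists_isCompact_isSiegelDelta_mul`, the continuous height of record ★
`exists_siegelHeight_continuous`, its decay-integrability (`doublingHeightDecay_of_adelicNormIntegrable`), and ★ p854882
`exists_threshold_integrable_comp_iotaLeft_of_continuous_height` (`|f(pk)| ≤ ‖f|_K‖_∞ |χ(det_Δ p)| |det_Δ p|^{Re s + n∕2}`).
[cite: Liu2021, Lem. B.10 (2) p. 102] [cite: GelbartPiatetskishapiroRallis1987, Part A §1] -/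
theorem doublingSectionIntegrable_of_adelicNormIntegrable
    (h16b :
      ∀ (L : Type) [Field L] [NumberField L] [IsCMField L] {N : ℕ}
        (dV : Fin N → L) (_hdV : ∀ i, IsCMField.complexConj L (dV i) = dV i) (_hdV0 : ∀ i, dV i ≠ 0),
        ∃ β₀ : ℝ, ∀ β : ℝ, β₀ < β →
          ∀ [MeasurableSpace (UnitaryGroup.adelic (Fp L) L (IsCMField.complexConj L) N (Matrix.diagonal dV))]
            [BorelSpace (UnitaryGroup.adelic (Fp L) L (IsCMField.complexConj L) N (Matrix.diagonal dV))]
            (ν : Measure (UnitaryGroup.adelic (Fp L) L (IsCMField.complexConj L) N (Matrix.diagonal dV)))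
            [ν.IsHaarMeasure],
            Integrable (fun g : UnitaryGroup.adelic (Fp L) L (IsCMField.complexConj L) N (Matrix.diagonal dV) =>
              adelicHeightGL N L (g : GL (Fin N) (AdeleRing (𝓞 L) L)) ^ (-β)) ν) :
    ∀ (L : Type) [Field L] [NumberField L] [IsCMField L] {N n : ℕ} (e : Fin N × Fin 1 ≃ Fin n)
      (dV : Fin N → L) (hdV : ∀ i, IsCMField.complexConj L (dV i) = dV i) (_hdV0 : ∀ i, dV i ≠ 0)
      (dW : Fin 1 → L) (hdW : ∀ i, IsCMField.complexConj L (dW i) = dW i) (_hdW0 : ∀ i, dW i ≠ 0)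
      (χ : HeckeCharacter L),
      ∃ σ₀ : ℝ, ∀ (s : ℂ), σ₀ < s.re →
        ∀ (f : HA L e dV hdV dW hdW → ℂ), IsSiegelDeltaSection L e dV hdV dW hdW χ s f → Continuous f →
          ∀ [MeasurableSpace (UnitaryGroup.adelic (Fp L) L (IsCMField.complexConj L) N (Matrix.diagonal dV))]
            [BorelSpace (UnitaryGroup.adelic (Fp L) L (IsCMField.complexConj L) N (Matrix.diagonal dV))]
            (ν : Measure (UnitaryGroup.adelic (Fp L) L (IsCMField.complexConj L) N (Matrix.diagonal dV)))
            [ν.IsHaarMeasure],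
            Integrable (fun g => f (iotaLeft L e dV hdV dW hdW g)) ν := by
  intro L _ _ _ N n e dV hdV hdV0 dW hdW hdW0 χ
  obtain ⟨K, hK, hPK⟩ := K2LiuSiegelDoubledIwasawaCompact.exists_isCompact_isSiegelDelta_mul L e dV hdV dW hdW hdV0 hdW0
  obtain ⟨Φ, hΦc, hΦpos, hΦΔ, -, -⟩ := K2LiuSiegelDeltaHeightExists.exists_siegelHeight_continuous L e dV hdV dW hdW hdV0 hdW0
  obtain ⟨τ₁, hτ⟩ := doublingHeightDecay_of_adelicNormIntegrable h16b L e dV hdV hdV0 dW hdW hdW0 Φ hΦc hΦpos hΦΔ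
  exact K2LiuDoublingHeightComparison.exists_threshold_integrable_comp_iotaLeft_of_continuous_height L e dV hdV dW hdW χ hK hPK hΦc
    hΦpos hΦΔ hτ

end Summit.HodgeConjecture.HodgeConjecture.Cruxes.HLiu418.K2LiuDoublingHeightDecayOfNormIntegrable

end
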